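import Summits.QuantumFields.BalabanUV.Beta.GAN24.HkGradientKingOneStep
import Summits.QuantumFields.BalabanUV.Beta.GAN24.HkKingOneStepSup

/-!
# `BalabanUV.Beta.GAN24.HkGradientKingRate` — binder row G-an2-4 ∕ (CONV-C), route R7 (ρ3) GRADIENT PART, road P2: THE GRADIENT LEG `∂_νH_k` OF
# BAŁABAN's MINIMISER OBEYS BOTH (CONV-C) CLAUSES AGAINST KING's PARENT — UNCONDITIONALLY, every torus, kernel AND `sup → sup` currency —
# with the geometric rate `θ_α = L^{−α∕2}` (any `0 ≤ α < 1`) and the full decay `e^{−dec(d)·|y′−y|_T}`: the plug of gan24-p3-g27's VALUE law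
# `HkKingOneStep.norm_HkOp_king_sub_le` into road P2's secant reduction `HkGradientKingOneStep.norm_dker_king_sub_le_of_value_law`

NOT IN PRINT; OUR PROOF ATTEMPT (unit `b2b-balaban-gan24-p2`, gen 31 = prover-b2b-balaban-gan24-p2-g31-0, road-P2 chair of row G-an2-4;
CRUX TEAM (2) under the ruling «YM REDIRECT TOWARDS THE SUMMIT», 2026-08-21).  HONEST FRAMING (cell contract, verbatim): «discharging
`BetaPertH` makes Bałaban's UV stability UNCONDITIONAL — a real constructive-QFT result; it is NOT the continuum limit and NOT the Clay
problem.»  HONEST DEPENDENCY (verbatim): «continuum YM on T⁴ ⇐ BetaPertH ∧ nine spine estimates (0/9 proved); BetaPertH ⇐ (D1) ∧ (D4) ∧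
CAP+tail; G-an2-4 gates asym, D1 and NE2/3/4.»  ABSOLUTE RULE: nothing printed is a hypothesis; no `def … : Prop`, no `sorry`; [folklore]
real analysis over TREE theorems BY NAME: gan24-p3-g27's `HkKingOneStep` (A1, p274692) ∕ `HkKingOneStepSup` (A2: `parDigit`, `eq_bpt_and_par_eq`),
b05's `B5Hk163TorusHolderRate` (`sum_exp_torusSupNorm_sub_rep_le`, the Hölder constant `CHR`) and `B5Hk163TorusHolder.fdiff_HkOp_mulVec`
(the operator `∂_νH_k = fdiff * HkOp` has kernel `dker`), this lineage's `HkGradientSecant` ∕ `HkGradientKingOneStep`.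

## Content (0 sorry; `U = 1`, torus model, dimension `d+1 ≥ 1`, every period vector `M`)

 * §1 **`norm_dker_king_sub_le_of_steps`** (every `N, R ≥ 1`, every `1 ≤ h ≤ N∕2`, `0 ≤ α < 1`):
   `‖∂_ν^{(RN)}H_{RN}((RN·x̄′+a′,μ),(x̄,λ)) − ∂_ν^{(N)}H_N((N·x̄′+⌊a′∕R⌋,μ),(x̄,λ))‖ ≤ (2·CHR(d,α)·(h∕N)^α + 2·KH1(d)∕h)·e^{−dec(d)·|x′−x|_T}`;
   `norm_dker_two_levels_le` (the degenerate bound `2·CdecD·e^{−dec|x′−x|}`, any two levels).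
 * §2 THE TOWER `N = n_k = L^k`, `R = L ≥ 2`, with `h = n_{⌊k∕2⌋}`: **`norm_dker_king_sub_le_lev`**:
   `‖∂_ν^{(n_{k+1})}H_{k+1}((n_{k+1}·x̄′+a′,μ),(x̄,λ)) − ∂_ν^{(n_k)}H_k((n_k·x̄′+⌊a′∕L⌋,μ),(x̄,λ))‖ ≤ CG(d,α,L)·θG(L,α)^k·e^{−dec(d)·|x′−x|_T}`,
   `θG(L,α) = (L⁻¹)^{α∕2} < 1`, `CG(d,α,L) = 2·CHR(d,α) + 2·KH1(d)·L` (`rpow` bookkeeping `hN_ratio_rpow_le`, `inv_h_le`).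
 * §3 at an ARBITRARY fine bond `X′` of level `k+1` against `par X′` (A2's `eq_bpt_and_par_eq`): **`norm_dker_par_sub_le_lev`**.
 * §4 ROW SUMS and the **`sup → sup` GRADIENT-LEG LAW** on bounded unit-lattice fields: **`norm_fdiff_HkOp_par_mulVec_sub_le_lev`**:
   `‖(∂_ν^{(n_{k+1})}H_{k+1}B)(X′) − (∂_ν^{(n_k)}H_kB)(par X′)‖ ≤ CGs(d,α,L)·θG(L,α)^k·‖B‖_∞`, `CGs = CG·(d+1)·latticeConst(d+1, dec d)` — volume-uniform.
 * §5 **`dhk_king_two_clauses_lev`**: the census sentence — `∃ κ > 0, C ≥ 0, θ ∈ [0,1)` with (i) `‖∂_νH_k(X,(y,λ))‖ ≤ C·e^{−κ|ȳ(X)−ȳ(y)|_T}` and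
   (ii) `‖∂_νH_{k+1}(X′,(y,λ)) − ∂_νH_k(par X′,(y,λ))‖ ≤ C·θ^k·e^{−κ|ȳ(X′)−ȳ(y)|_T}` for all `k`, `X′`, `y`, `λ`, `ν`, `μ` — BOTH (CONV-C) CLAUSES for the
   constituent family `∂H_k` at `U = 1`, King-parent currency.
HONEST.  The exponent `α∕2 < ½` per level (θG = L^{−α∕2}) is an ARTEFACT of the secant interpolation (choice `h = n_{⌊k∕2⌋}`; the optimum
`h ≍ N^{1∕(1+α)}` gives `α∕(1+α)`, still `< ½`, Landau–Kolmogorov-sharp for the two inputs per gan24-idea-1 g11's W-idea1-g11-1), below the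
`η^γ, ∀ γ < 1` of King's §4 alias count for the gradient line ((4.25) p. 673, located by gan24-leaf-04 g51); `η¹` is printed nowhere for `∂H_k`
and idea-1's scalar toy j132961 measures `η·log(1∕η)` in sup; (CONV-C)'s `θ` is free.  Constants ours∕b05's, crude, `d`-only apart from `α`, `L`; `CHR(d,α) → ∞` as `α ↑ 1`.  NOT (CONV-C) as a whole, NEVER «G-an2-4 closed»,
NOT NE2, NOT D1, NOT BetaPertH, NOT continuum, NOT Clay.  Text locations only: [Balaban1984PropagatorsI] (1.31) p. 23, (1.63) p. 28, p. 29
lines 1–2; [King1986] p. 664 (parent map), Prop. 3.8 (3.71) p. 664 (scalar VALUE template — no gradient statement is printed there).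
-/

noncomputable section

open scoped BigOperators Matrix
open Finset

namespace Summit.QuantumFields.BalabanUV.Beta.GAN24.HkGradientKingRate

open Literature.MathematicalPhysics.QuantumFieldTheory.Balaban1983to89
open Literature.MathematicalPhysics.QuantumFieldTheory.Balaban1983to89.B5Prop11Plancherel (Tor fine unitVec fdiff)
open Literature.MathematicalPhysics.QuantumFieldTheory.Balaban1983to89.B4TorusKernel (periodConst)
open Literature.MathematicalPhysics.QuantumFieldTheory.Balaban1983to89.B4TorusKernel.MultiPeriod (torusSupNorm)
open Literature.MathematicalPhysics.QuantumFieldTheory.Balaban1983to89.B4Sect5Proof (latticeConst latticeConst_nonneg)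
open Literature.MathematicalPhysics.QuantumFieldTheory.Balaban1983to89.B5Block118 (bpt)
open Literature.MathematicalPhysics.QuantumFieldTheory.Balaban1983to89.B5Blocks16 (blockOf)
open Literature.MathematicalPhysics.QuantumFieldTheory.Balaban1983to89.B6LowerBound2153Torus (toT rep toT_rep)
open Literature.MathematicalPhysics.QuantumFieldTheory.Balaban1983to89.B5G183RateUnitTower (lev lev_neZero)
open Literature.MathematicalPhysics.QuantumFieldTheory.Balaban1983to89.B5Hk163Strip (kappa163 kappa163_pos)
open Literature.MathematicalPhysics.QuantumFieldTheory.Balaban1983to89.B5Hk163Torus (HkOp)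
open Literature.MathematicalPhysics.QuantumFieldTheory.Balaban1983to89.B5Hk163TorusHolder (dker fdiff_HkOp_mulVec)
open Literature.MathematicalPhysics.QuantumFieldTheory.Balaban1983to89.B5Hk163TorusHolderDecay (CdecD CdecD_nonneg norm_dker_bpt_le)
open Literature.MathematicalPhysics.QuantumFieldTheory.Balaban1983to89.B5Hk163TorusHolderRate (CHR CHR_nonneg sum_exp_torusSupNorm_sub_rep_le)
open Literature.MathematicalPhysics.QuantumFieldTheory.Balaban1983to89.Beta.FluctuationProjection (digitOf)
open Summit.QuantumFields.BalabanUV.T4Continuum.BalabanAveragedTowerModes (par)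
open Summit.QuantumFields.BalabanUV.T4Continuum.BalabanAveragedTowerUnit (one_le_lev' cast_lev' lev_succ')
open Summit.QuantumFields.BalabanUV.Beta.GAN24.HkKingOneStep (dec dec_pos KH1 KH1_nonneg norm_HkOp_king_sub_le)
open Summit.QuantumFields.BalabanUV.Beta.GAN24.HkKingOneStepSup (parDigit eq_bpt_and_par_eq)
open Summit.QuantumFields.BalabanUV.Beta.GAN24.HkGradientKingOneStep (norm_dker_king_sub_le_of_value_law norm_dker_trivial_two_levels
  two_CdecD_le_CHR)

variable {d : ℕ}

/-- `dec d` IS b05's decay rate `κ₁₆₃(d+1)∕(d+1)` (p3's abbreviation, definitional). [folklore] -/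
theorem dec_eq (d : ℕ) : dec d = kappa163 (d + 1) / (d + 1) := rfl

/-! ## §1 Every `N, R`: the unconditional `h`-form -/

section King

variable {N R : ℕ} [NeZero N] [NeZero R] (M : Fin (d + 1) → ℕ) [hM : ∀ μ, NeZero (M μ)]

/-- **THE GRADIENT ONE-STEP LAW AGAINST KING's PARENT, KERNEL CURRENCY, `h`-FORM — UNCONDITIONAL** (every torus, every `N, R ≥ 1`, every
`h` with `1 ≤ h`, `2h ≤ N`, every `0 ≤ α < 1`):
`‖∂_ν^{(RN)}H_{RN}((RN·x̄′+a′,μ),(x̄,λ)) − ∂_ν^{(N)}H_N((N·x̄′+⌊a′∕R⌋,μ),(x̄,λ))‖ ≤ (2·CHR(d,α)·(h∕N)^α + 2·KH1(d)∕h)·e^{−dec(d)·|x′−x|_T}`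
(road P2's secant reduction + gan24-p3-g27's value law `KH1∕N·e^{−dec|x′−x|}` BY NAME).
[cite: Balaban1984PropagatorsI, (1.63) p.28, p.29 lines 1–2; King1986, p.664] [folklore] -/
theorem norm_dker_king_sub_le_of_steps (μ lam ν : Fin (d + 1)) (x' x : Fin (d + 1) → ℤ) (a : Fin (d + 1) → Fin N)
    (a' : Fin (d + 1) → Fin (R * N)) (hpar : ∀ i, (a' i : ℕ) / R = (a i : ℕ)) {h : ℕ} (hh : 1 ≤ h) (h2 : 2 * h ≤ N)
    {α : ℝ} (hα0 : 0 ≤ α) (hα1 : α < 1) :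
    ‖dker (R * N) M μ lam ν (bpt (R * N) M (toT M x') a') (toT M x) - dker N M μ lam ν (bpt N M (toT M x') a) (toT M x)‖
      ≤ (2 * CHR d α * ((h : ℝ) / N) ^ α + 2 * KH1 d / h) * Real.exp (-(dec d * torusSupNorm M (x' - x))) := by
  have hN : (0 : ℝ) < N := by exact_mod_cast Nat.pos_of_ne_zero (NeZero.ne N)
  have hh0 : (0 : ℝ) < h := by exact_mod_cast hh
  set E := Real.exp (-(dec d * torusSupNorm M (x' - x))) with hE
  have key := norm_dker_king_sub_le_of_value_law M μ lam ν x' x (ε := KH1 d / N * E)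
    (fun b b' hb => norm_HkOp_king_sub_le M μ lam x' x b b' hb) a a' hpar hh h2 hα0 hα1
  rw [← dec_eq] at key
  calc _ ≤ _ := key
    _ = (2 * CHR d α * ((h : ℝ) / N) ^ α + 2 * KH1 d / h) * E := by
        field_simp
        ring

/-- **the degenerate two-level bound** `≤ 2·CdecD(d)·e^{−dec(d)·|x′−x|_T}` (two decaying sup bounds of b05; no parent relation needed). [folklore] -/
theorem norm_dker_two_levels_le (μ lam ν : Fin (d + 1)) (x' x : Fin (d + 1) → ℤ) (a : Fin (d + 1) → Fin N)
    (a' : Fin (d + 1) → Fin (R * N)) :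
    ‖dker (R * N) M μ lam ν (bpt (R * N) M (toT M x') a') (toT M x) - dker N M μ lam ν (bpt N M (toT M x') a) (toT M x)‖
      ≤ 2 * CdecD d * Real.exp (-(dec d * torusSupNorm M (x' - x))) := by
  rw [dec_eq]; exact norm_dker_trivial_two_levels M μ lam ν x' x a a'

end King

/-! ## §2 The tower `n_k = L^k`, `R = L`: the geometric rate `θG = L^{−α∕2}` -/

section Tower

/-- **the gradient-leg rate per level**: `θG(L,α) = (L⁻¹)^{α∕2}`. OURS. [folklore] -/
def thetaG (L : ℕ) (α : ℝ) : ℝ := ((L : ℝ)⁻¹) ^ (α / 2)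

/-- **the gradient-leg one-step constant**: `CG(d,α,L) = 2·CHR(d,α) + 2·KH1(d)·L`. OURS. [folklore] -/
def CG (d : ℕ) (α : ℝ) (L : ℕ) : ℝ := 2 * CHR d α + 2 * KH1 d * L

/-- `0 < θG`. [folklore] -/
theorem thetaG_pos {L : ℕ} (hL : 1 ≤ L) (α : ℝ) : 0 < thetaG L α := by
  unfold thetaG; exact Real.rpow_pos_of_pos (inv_pos.mpr (by exact_mod_cast hL)) _

/-- `θG ≤ 1` for `L ≥ 1`, `α ≥ 0`. [folklore] -/
theorem thetaG_le_one {L : ℕ} (hL : 1 ≤ L) {α : ℝ} (hα0 : 0 ≤ α) : thetaG L α ≤ 1 := by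
  unfold thetaG
  have hL' : (1 : ℝ) ≤ L := by exact_mod_cast hL
  exact Real.rpow_le_one (inv_nonneg.mpr (by positivity)) (inv_le_one_of_one_le₀ hL') (by linarith)

/-- `θG < 1` for `L ≥ 2`, `α > 0` — the (CONV-C) rate condition. [folklore] -/
theorem thetaG_lt_one {L : ℕ} (hL : 2 ≤ L) {α : ℝ} (hα : 0 < α) : thetaG L α < 1 := by
  unfold thetaG
  have hL' : (2 : ℝ) ≤ L := by exact_mod_cast hL
  exact Real.rpow_lt_one (inv_nonneg.mpr (by positivity)) (inv_lt_one_of_one_lt₀ (by linarith)) (by linarith)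

/-- `0 ≤ CG`. [folklore] -/
theorem CG_nonneg (d : ℕ) (α : ℝ) (L : ℕ) : 0 ≤ CG d α L := by
  have := CHR_nonneg (d := d) α; have := KH1_nonneg d; unfold CG; positivity

/-- `2·CHR(d,α) ≤ CG(d,α,L)` (hence `2·CdecD ≤ CG` too). [folklore] -/
theorem two_CHR_le_CG (d : ℕ) (α : ℝ) (L : ℕ) : 2 * CHR d α ≤ CG d α L := by
  have := KH1_nonneg d; unfold CG; nlinarith [Nat.cast_nonneg (α := ℝ) L]

/-- `rpow` bookkeeping (i): `(n_{⌊k∕2⌋} ∕ n_k)^α ≤ θG^k` for `L ≥ 1`, `0 ≤ α`. [folklore] -/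
theorem ratio_rpow_le_thetaG_pow {L : ℕ} (hL : 1 ≤ L) (k : ℕ) {α : ℝ} (hα0 : 0 ≤ α) :
    (((lev L (k / 2) : ℕ) : ℝ) / ((lev L k : ℕ) : ℝ)) ^ α ≤ thetaG L α ^ k := by
  have hL0 : (0 : ℝ) < L := by exact_mod_cast hL
  have hx0 : 0 < ((L : ℝ)⁻¹) := inv_pos.mpr hL0
  have hx1 : ((L : ℝ)⁻¹) ≤ 1 := inv_le_one_of_one_le₀ (by exact_mod_cast hL)
  have hjk : k / 2 ≤ k := Nat.div_le_self k 2
  -- the ratio is `(L⁻¹)^(k − k/2)`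
  have hratio : ((lev L (k / 2) : ℕ) : ℝ) / ((lev L k : ℕ) : ℝ) = ((L : ℝ)⁻¹) ^ (k - k / 2) := by
    rw [cast_lev', cast_lev', inv_pow, ← one_div, eq_div_iff (pow_ne_zero _ hL0.ne'), div_mul_eq_mul_div, ← pow_add,
      Nat.add_sub_cancel' hjk, div_self (pow_ne_zero _ hL0.ne')]
  rw [hratio, ← Real.rpow_natCast_mul hx0.le, thetaG, ← Real.rpow_mul_natCast hx0.le]
  apply Real.rpow_le_rpow_of_exponent_ge hx0 hx1
  -- `α/2·k ≤ (k − k/2)·α`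
  have h2 : (((k - k / 2 : ℕ)) : ℝ) ≥ (k : ℝ) / 2 := by
    have hdiv : 2 * (k / 2) ≤ k := Nat.mul_div_le k 2
    have hcast : (((k - k / 2 : ℕ)) : ℝ) = (k : ℝ) - ((k / 2 : ℕ) : ℝ) := by rw [Nat.cast_sub hjk]
    have h3 : (((k / 2 : ℕ)) : ℝ) * 2 ≤ k := by exact_mod_cast (by omega : (k / 2) * 2 ≤ k)
    rw [hcast]; linarith
  nlinarith

/-- `rpow` bookkeeping (ii): `1 ∕ n_{⌊k∕2⌋} ≤ L·θG^k` for `L ≥ 1`, `0 ≤ α ≤ 1`. [folklore] -/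
theorem inv_lev_half_le {L : ℕ} (hL : 1 ≤ L) (k : ℕ) {α : ℝ} (hα1 : α ≤ 1) :
    (((lev L (k / 2) : ℕ) : ℝ))⁻¹ ≤ (L : ℝ) * thetaG L α ^ k := by
  have hL0 : (0 : ℝ) < L := by exact_mod_cast hL
  have hL1 : (1 : ℝ) ≤ L := by exact_mod_cast hL
  have hx0 : 0 < ((L : ℝ)⁻¹) := inv_pos.mpr hL0
  have hx1 : ((L : ℝ)⁻¹) ≤ 1 := inv_le_one_of_one_le₀ hL1
  rw [cast_lev', ← inv_pow, ← Real.rpow_natCast, thetaG, ← Real.rpow_mul_natCast hx0.le]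
  -- `(L⁻¹)^j ≤ (L⁻¹)^((k−1)/2) = L^{1/2}·(L⁻¹)^(k/2) ≤ L·(L⁻¹)^(α/2·k)`
  have hj : ((k : ℝ) - 1) / 2 ≤ ((k / 2 : ℕ) : ℝ) := by
    have h3 : k ≤ (k / 2) * 2 + 1 := by omega
    have h4 : (k : ℝ) ≤ ((k / 2 : ℕ) : ℝ) * 2 + 1 := by exact_mod_cast h3
    linarith
  have step1 : ((L : ℝ)⁻¹) ^ (((k / 2 : ℕ) : ℝ)) ≤ ((L : ℝ)⁻¹) ^ (((k : ℝ) - 1) / 2) :=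
    Real.rpow_le_rpow_of_exponent_ge hx0 hx1 hj
  have step2 : ((L : ℝ)⁻¹) ^ (((k : ℝ) - 1) / 2) = (L : ℝ) ^ ((1 : ℝ) / 2) * ((L : ℝ)⁻¹) ^ ((k : ℝ) / 2) := by
    rw [show ((k : ℝ) - 1) / 2 = (k : ℝ) / 2 + (-(1 / 2 : ℝ)) by ring, Real.rpow_add hx0, Real.inv_rpow hL0.le (-(1/2)),
      Real.rpow_neg hL0.le, inv_inv, mul_comm]
  have step3 : (L : ℝ) ^ ((1 : ℝ) / 2) ≤ L := by
    conv_rhs => rw [← Real.rpow_one (L : ℝ)]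
    exact Real.rpow_le_rpow_of_exponent_le hL1 (by norm_num)
  have step4 : ((L : ℝ)⁻¹) ^ ((k : ℝ) / 2) ≤ ((L : ℝ)⁻¹) ^ (α / 2 * k) :=
    Real.rpow_le_rpow_of_exponent_ge hx0 hx1 (by nlinarith [Nat.cast_nonneg (α := ℝ) k])
  calc ((L : ℝ)⁻¹) ^ (((k / 2 : ℕ) : ℝ)) ≤ (L : ℝ) ^ ((1 : ℝ) / 2) * ((L : ℝ)⁻¹) ^ ((k : ℝ) / 2) := step1.trans_eq step2
    _ ≤ L * ((L : ℝ)⁻¹) ^ (α / 2 * k) :=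
        mul_le_mul step3 step4 (Real.rpow_nonneg hx0.le _) hL0.le

variable (L : ℕ) [NeZero L] (M : Fin (d + 1) → ℕ) [hM : ∀ μ, NeZero (M μ)]

/-- **THE GRADIENT ONE-STEP LAW ALONG THE TOWER, KERNEL CURRENCY — UNCONDITIONAL**: for `L ≥ 2`, every level `k`, every torus, unit points
`x̄′, x̄`, components `μ, λ`, direction `ν`, a level-`(k+1)` offset `a′` with parent `a = ⌊a′∕L⌋` and `0 ≤ α < 1`:
`‖∂_ν^{(n_{k+1})}H_{k+1}((n_{k+1}·x̄′+a′,μ),(x̄,λ)) − ∂_ν^{(n_k)}H_k((n_k·x̄′+a,μ),(x̄,λ))‖ ≤ CG(d,α,L)·θG(L,α)^k·e^{−dec(d)·|x′−x|_T}` (`k ≥ 1`: §1 with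
`h = n_{⌊k∕2⌋}`; `k = 0`: the degenerate bound). [cite: Balaban1984PropagatorsI, (1.63) p.28, p.29 lines 1–2; King1986, p.664] [folklore] -/
theorem norm_dker_king_sub_le_lev (hL : 2 ≤ L) (k : ℕ) (μ lam ν : Fin (d + 1)) (x' x : Fin (d + 1) → ℤ)
    (a : Fin (d + 1) → Fin (lev L k)) (a' : Fin (d + 1) → Fin (L * lev L k)) (hpar : ∀ i, (a' i : ℕ) / L = (a i : ℕ))
    {α : ℝ} (hα0 : 0 ≤ α) (hα1 : α < 1) :
    ‖dker (L * lev L k) M μ lam ν (bpt (L * lev L k) M (toT M x') a') (toT M x)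
        - dker (lev L k) M μ lam ν (bpt (lev L k) M (toT M x') a) (toT M x)‖
      ≤ CG d α L * thetaG L α ^ k * Real.exp (-(dec d * torusSupNorm M (x' - x))) := by
  have hL1 : 1 ≤ L := le_trans (by norm_num) hL
  have hL0 : (0 : ℝ) < L := by exact_mod_cast hL1
  set E := Real.exp (-(dec d * torusSupNorm M (x' - x))) with hE
  have hE0 : 0 ≤ E := (Real.exp_pos _).le
  have hθ0 : 0 ≤ thetaG L α ^ k := pow_nonneg (thetaG_pos hL1 α).le k
  rcases Nat.eq_zero_or_pos k with hk | hk
  · -- `k = 0`: the degenerate bound, `2·CdecD ≤ 2·CHR ≤ CG`, `θ^0 = 1`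
    subst hk
    refine (norm_dker_two_levels_le M μ lam ν x' x a a').trans ?_
    rw [pow_zero, mul_one]
    refine mul_le_mul_of_nonneg_right ?_ hE0
    have h1 := two_CdecD_le_CHR (d := d) α
    have h2 := two_CHR_le_CG d α L
    have h3 := CHR_nonneg (d := d) α
    linarith
  · -- `k ≥ 1`: `h = n_{⌊k/2⌋}`
    have hh : 1 ≤ lev L (k / 2) := one_le_lev' L (k / 2)
    have h2 : 2 * lev L (k / 2) ≤ lev L k := by
      have hpow : ∀ j, lev L j = L ^ j := fun j => by
        induction j with
        | zero => rfl
        | succ j ih => rw [lev_succ', ih, pow_succ, mul_comm]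
      rw [hpow, hpow]
      have hsplit : L ^ k = L ^ (k / 2) * L ^ (k - k / 2) := by rw [← pow_add, Nat.add_sub_cancel' (Nat.div_le_self k 2)]
      rw [hsplit, mul_comm]
      have hge : 2 ≤ L ^ (k - k / 2) := le_trans hL (Nat.le_self_pow (by omega) L)
      exact Nat.mul_le_mul_left _ hge
    refine (norm_dker_king_sub_le_of_steps M μ lam ν x' x a a' hpar hh h2 hα0 hα1).trans ?_
    refine mul_le_mul_of_nonneg_right ?_ hE0
    have hA := ratio_rpow_le_thetaG_pow hL1 k hα0
    have hB := inv_lev_half_le hL1 k hα1.le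
    have hC := CHR_nonneg (d := d) α
    have hK := KH1_nonneg d
    calc 2 * CHR d α * ((((lev L (k / 2) : ℕ)) : ℝ) / ((lev L k : ℕ) : ℝ)) ^ α + 2 * KH1 d / ((lev L (k / 2) : ℕ) : ℝ)
        ≤ 2 * CHR d α * thetaG L α ^ k + 2 * KH1 d * ((L : ℝ) * thetaG L α ^ k) := by
          rw [div_eq_mul_inv (2 * KH1 d)]
          exact add_le_add (mul_le_mul_of_nonneg_left hA (by positivity)) (mul_le_mul_of_nonneg_left hB (by positivity))
      _ = CG d α L * thetaG L α ^ k := by rw [CG]; ring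

/-! ## §3 At an arbitrary fine bond against `par` (gan24-p3-g27's block coordinates BY NAME) -/

/-- **THE ENTRY LAW AT AN ARBITRARY FINE BOND** `X′` of level `k+1` against its King parent `par X′` (A2's `eq_bpt_and_par_eq`): with
`ȳ′ = rep (blockOf X′.1)` and any lattice representative `y` of the source block,
`‖∂_ν^{(n_{k+1})}H_{k+1}(X′,(ȳ,λ)) − ∂_ν^{(n_k)}H_k(par X′,(ȳ,λ))‖ ≤ CG(d,α,L)·θG(L,α)^k·e^{−dec(d)·|ȳ′−y|_T}`. [folklore] -/
theorem norm_dker_par_sub_le_lev (hL : 2 ≤ L) (k : ℕ) (X' : Tor (fine (L * lev L k) M) × Fin (d + 1)) (ν lam : Fin (d + 1))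
    (y : Fin (d + 1) → ℤ) {α : ℝ} (hα0 : 0 ≤ α) (hα1 : α < 1) :
    ‖dker (L * lev L k) M X'.2 lam ν X'.1 (toT M y) - dker (lev L k) M X'.2 lam ν (par (lev L k) L M X'.1) (toT M y)‖
      ≤ CG d α L * thetaG L α ^ k * Real.exp (-(dec d * torusSupNorm M (rep M (blockOf (L * lev L k) M X'.1) - y))) := by
  obtain ⟨x', μ⟩ := X'
  obtain ⟨hx, hp⟩ := eq_bpt_and_par_eq (N := lev L k) (R := L) M x'
  dsimp only
  rw [hp]
  have h := norm_dker_king_sub_le_lev L M hL k μ lam ν (rep M (blockOf (L * lev L k) M x')) y (parDigit M x')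
    (digitOf (L * lev L k) M x') (fun i => rfl) hα0 hα1
  rw [← hx] at h
  exact h

/-! ## §4 Row sums and the `sup → sup` gradient-leg law (volume-uniform) -/

/-- the row-sum constant `CGs(d,α,L) = CG(d,α,L)·(d+1)·latticeConst(d+1, dec d)`. OURS. [folklore] -/
def CGs (d : ℕ) (α : ℝ) (L : ℕ) : ℝ := CG d α L * ((d + 1) * latticeConst (d + 1) (dec d))

/-- `0 ≤ CGs`. [folklore] -/
theorem CGs_nonneg (d : ℕ) (α : ℝ) (L : ℕ) : 0 ≤ CGs d α L := by
  have h1 := CG_nonneg d α L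
  have h3 : (0 : ℝ) ≤ latticeConst (d + 1) (dec d) := latticeConst_nonneg _ (dec_pos d).le
  unfold CGs; positivity

/-- **ROW SUMS**: `Σ_{(y,λ)} ‖∂_νH_{k+1}(X′,(y,λ)) − ∂_νH_k(par X′,(y,λ))‖ ≤ CGs(d,α,L)·θG^k` — uniformly in the torus (King's lattice constant via
b05's `sum_exp_torusSupNorm_sub_rep_le`). [folklore] -/
theorem sum_norm_dker_par_sub_le_lev (hL : 2 ≤ L) (k : ℕ) (X' : Tor (fine (L * lev L k) M) × Fin (d + 1)) (ν : Fin (d + 1))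
    {α : ℝ} (hα0 : 0 ≤ α) (hα1 : α < 1) :
    ∑ i : Tor M × Fin (d + 1), ‖dker (L * lev L k) M X'.2 i.2 ν X'.1 i.1 - dker (lev L k) M X'.2 i.2 ν (par (lev L k) L M X'.1) i.1‖
      ≤ CGs d α L * thetaG L α ^ k := by
  have hL1 : 1 ≤ L := le_trans (by norm_num) hL
  have hθ0 : 0 ≤ thetaG L α ^ k := pow_nonneg (thetaG_pos hL1 α).le k
  set x' := rep M (blockOf (L * lev L k) M X'.1)
  rw [Fintype.sum_prod_type]
  calc ∑ y : Tor M, ∑ lam : Fin (d + 1), ‖dker (L * lev L k) M X'.2 lam ν X'.1 y - dker (lev L k) M X'.2 lam ν (par (lev L k) L M X'.1) y‖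
      ≤ ∑ y : Tor M, ∑ _lam : Fin (d + 1), CG d α L * thetaG L α ^ k * Real.exp (-(dec d * torusSupNorm M (x' - rep M y))) := by
        refine Finset.sum_le_sum fun y _ => Finset.sum_le_sum fun lam _ => ?_
        have h := norm_dker_par_sub_le_lev L M hL k X' ν lam (rep M y) hα0 hα1
        rwa [toT_rep] at h
    _ = CG d α L * thetaG L α ^ k * ((d + 1) * ∑ y : Tor M, Real.exp (-(dec d * torusSupNorm M (x' - rep M y)))) := by
        simp only [Finset.sum_const, Finset.card_univ, Fintype.card_fin, nsmul_eq_mul, Finset.mul_sum]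
        refine Finset.sum_congr rfl fun y _ => ?_
        push_cast; ring
    _ ≤ CG d α L * thetaG L α ^ k * ((d + 1) * latticeConst (d + 1) (dec d)) := by
        have hS := sum_exp_torusSupNorm_sub_rep_le M (dec_pos d) x'
        have hK : 0 ≤ CG d α L * thetaG L α ^ k := mul_nonneg (CG_nonneg d α L) hθ0
        exact mul_le_mul_of_nonneg_left (mul_le_mul_of_nonneg_left hS (by positivity)) hK
    _ = CGs d α L * thetaG L α ^ k := by rw [CGs]; ring

/-- **THE `sup → sup` ONE-STEP LAW OF THE GRADIENT LEG `∂_νH_k` AT `U = 1` ON BOUNDED UNIT-LATTICE FIELDS — UNCONDITIONAL**: for `L ≥ 2`,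
every level `k`, every torus, every fine bond `X′` of level `k+1`, every direction `ν`, `0 ≤ α < 1` and `‖B‖_∞ ≤ b`,
`‖(∂_ν^{(n_{k+1})}H_{k+1}B)(X′) − (∂_ν^{(n_k)}H_kB)(par X′)‖ ≤ CGs(d,α,L)·θG(L,α)^k·b` (the operator `∂_νH = fdiff * HkOp`, kernel `dker` by b05's
`fdiff_HkOp_mulVec`). [cite: Balaban1984PropagatorsI, (1.31) p.23, (1.63) p.28; King1986, Prop. 3.8 (3.71) p.664 (scalar value template)] [folklore] -/
theorem norm_fdiff_HkOp_par_mulVec_sub_le_lev (hL : 2 ≤ L) (k : ℕ) (B : Tor M × Fin (d + 1) → ℂ) {b : ℝ} (hb : ∀ i, ‖B i‖ ≤ b)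
    (X' : Tor (fine (L * lev L k) M) × Fin (d + 1)) (ν : Fin (d + 1)) {α : ℝ} (hα0 : 0 ≤ α) (hα1 : α < 1) :
    ‖(fdiff (fine (L * lev L k) M) ((L * lev L k : ℕ) : ℂ) ν *ᵥ (HkOp (L * lev L k) M *ᵥ B)) X'
        - (fdiff (fine (lev L k) M) ((lev L k : ℕ) : ℂ) ν *ᵥ (HkOp (lev L k) M *ᵥ B)) (par (lev L k) L M X'.1, X'.2)‖
      ≤ CGs d α L * thetaG L α ^ k * b := by
  have hb0 : 0 ≤ b := (norm_nonneg _).trans (hb ((0 : Tor M), ν))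
  obtain ⟨x', μ⟩ := X'
  have e : (fdiff (fine (L * lev L k) M) ((L * lev L k : ℕ) : ℂ) ν *ᵥ (HkOp (L * lev L k) M *ᵥ B)) (x', μ)
        - (fdiff (fine (lev L k) M) ((lev L k : ℕ) : ℂ) ν *ᵥ (HkOp (lev L k) M *ᵥ B)) (par (lev L k) L M x', μ)
      = ∑ i : Tor M × Fin (d + 1),
          (dker (L * lev L k) M μ i.2 ν x' i.1 - dker (lev L k) M μ i.2 ν (par (lev L k) L M x') i.1) * B i := by
    rw [fdiff_HkOp_mulVec, fdiff_HkOp_mulVec, Fintype.sum_prod_type]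
    simp only [← Finset.sum_sub_distrib, sub_mul]
  rw [e]
  calc _ ≤ ∑ i : Tor M × Fin (d + 1),
          ‖(dker (L * lev L k) M μ i.2 ν x' i.1 - dker (lev L k) M μ i.2 ν (par (lev L k) L M x') i.1) * B i‖ := norm_sum_le _ _
    _ ≤ ∑ i : Tor M × Fin (d + 1), ‖dker (L * lev L k) M μ i.2 ν x' i.1 - dker (lev L k) M μ i.2 ν (par (lev L k) L M x') i.1‖ * b := by
        refine Finset.sum_le_sum fun i _ => ?_
        rw [norm_mul]
        exact mul_le_mul_of_nonneg_left (hb i) (norm_nonneg _)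
    _ = (∑ i : Tor M × Fin (d + 1), ‖dker (L * lev L k) M μ i.2 ν x' i.1 - dker (lev L k) M μ i.2 ν (par (lev L k) L M x') i.1‖) * b := by
        rw [Finset.sum_mul]
    _ ≤ CGs d α L * thetaG L α ^ k * b :=
        mul_le_mul_of_nonneg_right (sum_norm_dker_par_sub_le_lev L M hL k (x', μ) ν hα0 hα1) hb0

/-! ## §5 The census sentence: both (CONV-C) clauses for the constituent family `∂H_k` at `U = 1` -/

/-- **THE GRADIENT LEG `∂H_k` OF (CONV-C) AT `U = 1` ALONG THE TOWER `n_k = L^k`, KING-PARENT CURRENCY, EVERY TORUS, EVERY FINE BOND** (`L ≥ 2`,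
one fixed `0 < α < 1`, here `α = 1∕2` so `θ = L^{−1∕4}`): there are `κ > 0`, `C ≥ 0`, `0 ≤ θ < 1` (functions of `d`, `L`) with, for every level
`k`, direction `ν`, fine bond `X` of level `k` (resp. `X′` of level `k+1`), unit point `y`, component `λ`:
 (i) `‖∂_νH_k(X,(y,λ))‖ ≤ C·e^{−κ|ȳ(X) − ȳ(y)|_T}` (b05's decay clause);
 (ii) `‖∂_νH_{k+1}(X′,(y,λ)) − ∂_νH_k(par X′,(y,λ))‖ ≤ C·θ^k·e^{−κ|ȳ(X′) − ȳ(y)|_T}`.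
[cite: Balaban1984PropagatorsI, (1.63) p.28, p.29 lines 1–2; King1986, p.664] [folklore] -/
theorem dhk_king_two_clauses_lev (hL : 2 ≤ L) :
    ∃ κ C θ : ℝ, 0 < κ ∧ 0 ≤ C ∧ 0 ≤ θ ∧ θ < 1 ∧
      (∀ (k : ℕ) (ν : Fin (d + 1)) (X : Tor (fine (lev L k) M) × Fin (d + 1)) (y : Tor M) (lam : Fin (d + 1)),
        ‖dker (lev L k) M X.2 lam ν X.1 y‖
          ≤ C * Real.exp (-(κ * torusSupNorm M (rep M (blockOf (lev L k) M X.1) - rep M y)))) ∧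
      (∀ (k : ℕ) (ν : Fin (d + 1)) (X' : Tor (fine (L * lev L k) M) × Fin (d + 1)) (y : Tor M) (lam : Fin (d + 1)),
        ‖dker (L * lev L k) M X'.2 lam ν X'.1 y - dker (lev L k) M X'.2 lam ν (par (lev L k) L M X'.1) y‖
          ≤ C * θ ^ k * Real.exp (-(κ * torusSupNorm M (rep M (blockOf (L * lev L k) M X'.1) - rep M y)))) := by
  have hL1 : 1 ≤ L := le_trans (by norm_num) hL
  refine ⟨dec d, max (CdecD d) (CG d (1/2) L), thetaG L (1/2), dec_pos d, le_max_of_le_left CdecD_nonneg,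
    (thetaG_pos hL1 _).le, thetaG_lt_one hL (by norm_num), ?_, ?_⟩
  · intro k ν X y lam
    obtain ⟨x, μ⟩ := X
    obtain ⟨hx, -⟩ := eq_bpt_and_par_eq (N := lev L k) (R := 1) M (cast (by rw [one_mul]) x)
    -- direct route: write `x` in block coordinates at level `n_k`
    have hx' : x = bpt (lev L k) M (toT M (rep M (blockOf (lev L k) M x))) (digitOf (lev L k) M x) := by
      rw [toT_rep, Beta.FluctuationProjection.bpt_blockOf_digitOf]
    have h := norm_dker_bpt_le (lev L k) M μ lam ν (digitOf (lev L k) M x) (rep M (blockOf (lev L k) M x)) (rep M y)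
    rw [← hx', toT_rep, ← dec_eq] at h
    dsimp only
    refine h.trans (mul_le_mul_of_nonneg_right ?_ (Real.exp_pos _).le)
    exact (le_max_left _ _).trans_eq' rfl
  · intro k ν X' y lam
    have h := norm_dker_par_sub_le_lev L M hL k X' ν lam (rep M y) (α := 1/2) (by norm_num) (by norm_num)
    rw [toT_rep] at h
    refine h.trans ?_
    exact mul_le_mul_of_nonneg_right (mul_le_mul_of_nonneg_right (le_max_right _ _) (pow_nonneg (thetaG_pos hL1 _).le k))
      (Real.exp_pos _).le

end Tower

end Summit.QuantumFields.BalabanUV.Beta.GAN24.HkGradientKingRate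

end
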